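import Mathlib
import Summits.ValiantsHypothesis.ValiantsHypothesis.Theorems.RigidityForcesSymmetryRankRigidMinimalReprLaplaceFiveStarWedgePoly

/-!
# ValiantsHypothesis / RigidityForcesSymmetry — crux `LaplaceOptimalFive` (stmt-ValiantsHypothesis-24813), crux idea
`young-shadow` (K1) on the star: **THE DICTIONARY — THE PAIR SUM OF A SIDE-SYMMETRIC LETTER TENSOR IS HALF A HESSIAN ENTRY**
(memo `NOTE-p4g15-24813-K1-star.md` §2 FACT 2.2 «`f = yᵀCy/20`, `E = C − Hess f`», §9 dictionary; memo
`NOTE-p4g16-24813-LemmaK-kernel.md` r2 §4 (i))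

For a letter tensor `H : Fin 5⁵ → ℂ` symmetric in its first two and in its last three slots, with cubic matrix
`C_{ab}(y) = Σ_{cde} H(a,b,c,d,e) X_cX_dX_e` and quintic `F_H = Σ H(i,j,k,l,m) X_iX_jX_kX_lX_m = Σ_{ab} X_aX_b C_{ab}`:

* `pderiv_quartic`, `pderiv_quintic` — first partials of quartic / quintic tensor forms (no symmetry assumed), peeled from
  ✓ `pderiv_cubic`;
* `hessian_quintic` — `∂_a∂_b F_H = Σ_{cde} (20 placements of a, b) X_cX_dX_e`;
* `cubicSum_swap12`, `cubicSum_swap23` — renaming of summation letters in `Σ_{cde} T(c,d,e)X_cX_dX_e`;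
* ★ `pairSum_cubic_eq_hessian` — with the symmetries: `2·Σ_{cde} S_H(a,b,c,d,e) X_cX_dX_e = ∂_a∂_b F_H`, where `S_H` is the
  10-term pair sum of ✓ `closed_vertex_sum` / ✓ `star_slack_sum`.  CONSEQUENCE for the assembly: the letter slack
  `E = H₁ − (1/10)S_{H₁}` of ✓ `star_slack_sum` reads, in cubic-matrix currency, `E_{ab} = C_{ab} − (1/20)∂_a∂_bF_{H₁}` — exactly the
  left side of ✓ `t1_slack_entry` (`40E_{ab} = 40C_{ab} − 2∂_a∂_bF`), so `L ∣ E_{ab}` in the T1 case.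

No definitions, no `sorry`.  Honest framing: (L3) dictionary brick, closes nothing; the rebasing and the final count remain;
K1-on-the-star PAPER PASS, not kernel; `LaplaceOptimalFive` OPEN · CONTESTED 72/120; `VP ≠ VNP` NOT proved.
-/

set_option linter.dupNamespace false

namespace Summit.ValiantsHypothesis.ValiantsHypothesis.Theorems.RigidityForcesSymmetryRankRigidMinimalRepr

namespace LaplaceFiveStar

open Finset MvPolynomial

/-- Peeling one variable: `∂_z Σ_a X_a·G_a = G_z + Σ_a X_a·∂_zG_a`. [folklore] -/
theorem pderiv_sum_X_mul (G : Fin 5 → MvPolynomial (Fin 5) ℂ) (z : Fin 5) :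
    pderiv z (∑ a : Fin 5, X a * G a) = G z + ∑ a : Fin 5, X a * pderiv z (G a) := by
  rw [map_sum]
  simp only [Derivation.leibniz, pderiv_X, smul_eq_mul, Pi.single_apply, mul_ite, mul_one, mul_zero,
    Finset.sum_add_distrib, Finset.sum_ite_eq', Finset.mem_univ, if_true]
  rw [add_comm]

/-- First partial of a quartic tensor form (no symmetry assumed). [folklore] -/
theorem pderiv_quartic (G : Fin 5 → Fin 5 → Fin 5 → Fin 5 → ℂ) (z : Fin 5) :
    pderiv z (∑ b : Fin 5, ∑ c : Fin 5, ∑ d : Fin 5, ∑ e : Fin 5,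
        C (G b c d e) * X b * X c * X d * X e : MvPolynomial (Fin 5) ℂ)
      = ∑ c : Fin 5, ∑ d : Fin 5, ∑ e : Fin 5, C (G z c d e + G c z d e + G c d z e + G c d e z) * X c * X d * X e := by
  have hpeel : (∑ b : Fin 5, ∑ c : Fin 5, ∑ d : Fin 5, ∑ e : Fin 5,
        C (G b c d e) * X b * X c * X d * X e : MvPolynomial (Fin 5) ℂ)
      = ∑ b : Fin 5, X b * (∑ c : Fin 5, ∑ d : Fin 5, ∑ e : Fin 5, C (G b c d e) * X c * X d * X e) := by
    refine Finset.sum_congr rfl fun b _ => ?_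
    rw [Finset.mul_sum]
    refine Finset.sum_congr rfl fun c _ => ?_
    rw [Finset.mul_sum]
    refine Finset.sum_congr rfl fun d _ => ?_
    rw [Finset.mul_sum]
    exact Finset.sum_congr rfl fun e _ => by ring
  rw [hpeel, pderiv_sum_X_mul]
  simp only [pderiv_cubic]
  have h2 : ∑ b : Fin 5, (X b : MvPolynomial (Fin 5) ℂ) * ∑ d : Fin 5, ∑ e : Fin 5,
      C (G b z d e + G b d z e + G b d e z) * X d * X e
      = ∑ c : Fin 5, ∑ d : Fin 5, ∑ e : Fin 5, C (G c z d e + G c d z e + G c d e z) * X c * X d * X e := by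
    refine Finset.sum_congr rfl fun c _ => ?_
    rw [Finset.mul_sum]
    refine Finset.sum_congr rfl fun d _ => ?_
    rw [Finset.mul_sum]
    exact Finset.sum_congr rfl fun e _ => by ring
  rw [h2, ← Finset.sum_add_distrib]
  refine Finset.sum_congr rfl fun c _ => ?_
  rw [← Finset.sum_add_distrib]
  refine Finset.sum_congr rfl fun d _ => ?_
  rw [← Finset.sum_add_distrib]
  refine Finset.sum_congr rfl fun e _ => ?_
  simp only [map_add]
  ring

/-- First partial of a quintic tensor form (no symmetry assumed). [folklore] -/
theorem pderiv_quintic (H : Fin 5 → Fin 5 → Fin 5 → Fin 5 → Fin 5 → ℂ) (z : Fin 5) :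
    pderiv z (∑ a : Fin 5, ∑ b : Fin 5, ∑ c : Fin 5, ∑ d : Fin 5, ∑ e : Fin 5,
        C (H a b c d e) * X a * X b * X c * X d * X e : MvPolynomial (Fin 5) ℂ)
      = ∑ b : Fin 5, ∑ c : Fin 5, ∑ d : Fin 5, ∑ e : Fin 5,
          C (H z b c d e + H b z c d e + H b c z d e + H b c d z e + H b c d e z) * X b * X c * X d * X e := by
  have hpeel : (∑ a : Fin 5, ∑ b : Fin 5, ∑ c : Fin 5, ∑ d : Fin 5, ∑ e : Fin 5,
        C (H a b c d e) * X a * X b * X c * X d * X e : MvPolynomial (Fin 5) ℂ)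
      = ∑ a : Fin 5, X a * (∑ b : Fin 5, ∑ c : Fin 5, ∑ d : Fin 5, ∑ e : Fin 5,
          C (H a b c d e) * X b * X c * X d * X e) := by
    refine Finset.sum_congr rfl fun a _ => ?_
    rw [Finset.mul_sum]
    refine Finset.sum_congr rfl fun b _ => ?_
    rw [Finset.mul_sum]
    refine Finset.sum_congr rfl fun c _ => ?_
    rw [Finset.mul_sum]
    refine Finset.sum_congr rfl fun d _ => ?_
    rw [Finset.mul_sum]
    exact Finset.sum_congr rfl fun e _ => by ring
  rw [hpeel, pderiv_sum_X_mul]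
  simp only [pderiv_quartic]
  have h2 : ∑ a : Fin 5, (X a : MvPolynomial (Fin 5) ℂ) * ∑ c : Fin 5, ∑ d : Fin 5, ∑ e : Fin 5,
      C (H a z c d e + H a c z d e + H a c d z e + H a c d e z) * X c * X d * X e
      = ∑ b : Fin 5, ∑ c : Fin 5, ∑ d : Fin 5, ∑ e : Fin 5,
          C (H b z c d e + H b c z d e + H b c d z e + H b c d e z) * X b * X c * X d * X e := by
    refine Finset.sum_congr rfl fun b _ => ?_
    rw [Finset.mul_sum]
    refine Finset.sum_congr rfl fun c _ => ?_
    rw [Finset.mul_sum]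
    refine Finset.sum_congr rfl fun d _ => ?_
    rw [Finset.mul_sum]
    exact Finset.sum_congr rfl fun e _ => by ring
  rw [h2, ← Finset.sum_add_distrib]
  refine Finset.sum_congr rfl fun b _ => ?_
  rw [← Finset.sum_add_distrib]
  refine Finset.sum_congr rfl fun c _ => ?_
  rw [← Finset.sum_add_distrib]
  refine Finset.sum_congr rfl fun d _ => ?_
  rw [← Finset.sum_add_distrib]
  refine Finset.sum_congr rfl fun e _ => ?_
  simp only [map_add]
  ring

/-- **Hessian of a quintic tensor form**: the 20 placements of `(a,b)`. [folklore] -/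
theorem hessian_quintic (H : Fin 5 → Fin 5 → Fin 5 → Fin 5 → Fin 5 → ℂ) (a b : Fin 5) :
    pderiv a (pderiv b (∑ i : Fin 5, ∑ j : Fin 5, ∑ k : Fin 5, ∑ l : Fin 5, ∑ m : Fin 5,
        C (H i j k l m) * X i * X j * X k * X l * X m : MvPolynomial (Fin 5) ℂ))
      = ∑ c : Fin 5, ∑ d : Fin 5, ∑ e : Fin 5,
          C ((H b a c d e + H a b c d e + H a c b d e + H a c d b e + H a c d e b)
            + (H b c a d e + H c b a d e + H c a b d e + H c a d b e + H c a d e b)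
            + (H b c d a e + H c b d a e + H c d b a e + H c d a b e + H c d a e b)
            + (H b c d e a + H c b d e a + H c d b e a + H c d e b a + H c d e a b)) * X c * X d * X e := by
  rw [pderiv_quintic, pderiv_quartic]

/-- Renaming `c ↔ d` in a cubic letter sum. [folklore] -/
theorem cubicSum_swap12 (T : Fin 5 → Fin 5 → Fin 5 → ℂ) :
    (∑ c : Fin 5, ∑ d : Fin 5, ∑ e : Fin 5, C (T c d e) * X c * X d * X e : MvPolynomial (Fin 5) ℂ)
      = ∑ c : Fin 5, ∑ d : Fin 5, ∑ e : Fin 5, C (T d c e) * X c * X d * X e := by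
  rw [Finset.sum_comm]
  exact Finset.sum_congr rfl fun c _ => Finset.sum_congr rfl fun d _ => Finset.sum_congr rfl fun e _ => by ring

/-- Renaming `d ↔ e` in a cubic letter sum. [folklore] -/
theorem cubicSum_swap23 (T : Fin 5 → Fin 5 → Fin 5 → ℂ) :
    (∑ c : Fin 5, ∑ d : Fin 5, ∑ e : Fin 5, C (T c d e) * X c * X d * X e : MvPolynomial (Fin 5) ℂ)
      = ∑ c : Fin 5, ∑ d : Fin 5, ∑ e : Fin 5, C (T c e d) * X c * X d * X e := by
  refine Finset.sum_congr rfl fun c _ => ?_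
  rw [Finset.sum_comm]
  exact Finset.sum_congr rfl fun d _ => Finset.sum_congr rfl fun e _ => by ring

/-- Splitting a cubic letter sum along a pointwise identity `T = T₁ + T₂`. [folklore] -/
theorem cubicSum_add (T T₁ T₂ : Fin 5 → Fin 5 → Fin 5 → ℂ) (h : ∀ c d e : Fin 5, T c d e = T₁ c d e + T₂ c d e) :
    (∑ c : Fin 5, ∑ d : Fin 5, ∑ e : Fin 5, C (T c d e) * X c * X d * X e : MvPolynomial (Fin 5) ℂ)
      = (∑ c : Fin 5, ∑ d : Fin 5, ∑ e : Fin 5, C (T₁ c d e) * X c * X d * X e)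
        + ∑ c : Fin 5, ∑ d : Fin 5, ∑ e : Fin 5, C (T₂ c d e) * X c * X d * X e := by
  rw [← Finset.sum_add_distrib]
  refine Finset.sum_congr rfl fun c _ => ?_
  rw [← Finset.sum_add_distrib]
  refine Finset.sum_congr rfl fun d _ => ?_
  rw [← Finset.sum_add_distrib]
  refine Finset.sum_congr rfl fun e _ => ?_
  rw [h, map_add]
  ring

/-- Scaling a cubic letter sum. [folklore] -/
theorem cubicSum_smul (T : Fin 5 → Fin 5 → Fin 5 → ℂ) (r : ℂ) :
    (∑ c : Fin 5, ∑ d : Fin 5, ∑ e : Fin 5, C (r * T c d e) * X c * X d * X e : MvPolynomial (Fin 5) ℂ)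
      = C r * ∑ c : Fin 5, ∑ d : Fin 5, ∑ e : Fin 5, C (T c d e) * X c * X d * X e := by
  rw [Finset.mul_sum]
  refine Finset.sum_congr rfl fun c _ => ?_
  rw [Finset.mul_sum]
  refine Finset.sum_congr rfl fun d _ => ?_
  rw [Finset.mul_sum]
  refine Finset.sum_congr rfl fun e _ => ?_
  rw [map_mul]
  ring

/-- **The dictionary.**  For `H` symmetric in slots `(1,2)`, `(3,4)`, `(4,5)`:
`2·Σ_{cde} S_H(a,b,c,d,e) X_cX_dX_e = ∂_a∂_b F_H`, `S_H` the 10-term pair sum, `F_H` the quintic of `H`.  Hence the letter slack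
`E = H − (1/10)S_H` is `C_{ab} − (1/20)∂_a∂_bF_H` in cubic-matrix currency. [folklore] -/
theorem pairSum_cubic_eq_hessian (H : Fin 5 → Fin 5 → Fin 5 → Fin 5 → Fin 5 → ℂ)
    (h12 : ∀ a b c d e : Fin 5, H a b c d e = H b a c d e) (h34 : ∀ a b c d e : Fin 5, H a b c d e = H a b d c e)
    (h45 : ∀ a b c d e : Fin 5, H a b c d e = H a b c e d) (a b : Fin 5) :
    2 * (∑ c : Fin 5, ∑ d : Fin 5, ∑ e : Fin 5,
        C (H a b c d e + H a c b d e + H a d b c e + H a e b c d + H b c a d e + H b d a c e + H b e a c d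
          + H c d a b e + H c e a b d + H d e a b c) * X c * X d * X e : MvPolynomial (Fin 5) ℂ)
      = pderiv a (pderiv b (∑ i : Fin 5, ∑ j : Fin 5, ∑ k : Fin 5, ∑ l : Fin 5, ∑ m : Fin 5,
          C (H i j k l m) * X i * X j * X k * X l * X m : MvPolynomial (Fin 5) ℂ)) := by
  -- symmetries of the long side
  have h35 : ∀ a b c d e : Fin 5, H a b c d e = H a b e d c := fun a b c d e => by rw [h34, h45, h34]
  -- the right side, canonicalised pointwise
  have hR : ∀ c d e : Fin 5,
      (H b a c d e + H a b c d e + H a c b d e + H a c d b e + H a c d e b)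
        + (H b c a d e + H c b a d e + H c a b d e + H c a d b e + H c a d e b)
        + (H b c d a e + H c b d a e + H c d b a e + H c d a b e + H c d a e b)
        + (H b c d e a + H c b d e a + H c d b e a + H c d e b a + H c d e a b)
      = 2 * H a b c d e + 6 * H a c b d e + 6 * H b c a d e + 6 * H c d a b e := by
    intro c d e
    have e1 : H b a c d e = H a b c d e := (h12 a b c d e).symm
    have e2 : H a c d b e = H a c b d e := (h34 a c b d e).symm
    have e3 : H a c d e b = H a c b d e := by rw [h45, ← h34]
    have e4 : H c b a d e = H b c a d e := (h12 b c a d e).symm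
    have e5 : H c a b d e = H a c b d e := (h12 a c b d e).symm
    have e6 : H c a d b e = H a c b d e := by rw [h12 c a, ← h34]
    have e7 : H c a d e b = H a c b d e := by rw [h12 c a, h45, ← h34]
    have e8 : H b c d a e = H b c a d e := (h34 b c a d e).symm
    have e9 : H c b d a e = H b c a d e := by rw [h12 c b, ← h34]
    have e10 : H c d b a e = H c d a b e := (h34 c d a b e).symm
    have e11 : H c d a e b = H c d a b e := (h45 c d a b e).symm
    have e12 : H b c d e a = H b c a d e := by rw [h35 b c d e a, h45]
    have e13 : H c b d e a = H b c a d e := by rw [h12 c b, h35 b c d e a, h45]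
    have e14 : H c d b e a = H c d a b e := by rw [h35 c d b e a, h45]
    have e15 : H c d e b a = H c d a b e := by rw [h35 c d e b a]
    have e16 : H c d e a b = H c d a b e := by rw [h34 c d e a b, h45]
    rw [e1, e2, e3, e4, e5, e6, e7, e8, e9, e10, e11, e12, e13, e14, e15, e16]
    ring
  rw [hessian_quintic]
  rw [show (∑ c : Fin 5, ∑ d : Fin 5, ∑ e : Fin 5,
      C ((H b a c d e + H a b c d e + H a c b d e + H a c d b e + H a c d e b)
        + (H b c a d e + H c b a d e + H c a b d e + H c a d b e + H c a d e b)
        + (H b c d a e + H c b d a e + H c d b a e + H c d a b e + H c d a e b)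
        + (H b c d e a + H c b d e a + H c d b e a + H c d e b a + H c d e a b)) * X c * X d * X e
        : MvPolynomial (Fin 5) ℂ)
      = ∑ c : Fin 5, ∑ d : Fin 5, ∑ e : Fin 5,
          C (2 * H a b c d e + 6 * H a c b d e + 6 * H b c a d e + 6 * H c d a b e) * X c * X d * X e from
    Finset.sum_congr rfl fun c _ => Finset.sum_congr rfl fun d _ => Finset.sum_congr rfl fun e _ => by rw [hR]]
  -- the left side: rename the six non-canonical pair terms
  have r1 : (∑ c : Fin 5, ∑ d : Fin 5, ∑ e : Fin 5, C (H a d b c e) * X c * X d * X e : MvPolynomial (Fin 5) ℂ)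
      = ∑ c : Fin 5, ∑ d : Fin 5, ∑ e : Fin 5, C (H a c b d e) * X c * X d * X e := by
    rw [cubicSum_swap12 (fun c d e => H a d b c e)]
  have r2 : (∑ c : Fin 5, ∑ d : Fin 5, ∑ e : Fin 5, C (H a e b c d) * X c * X d * X e : MvPolynomial (Fin 5) ℂ)
      = ∑ c : Fin 5, ∑ d : Fin 5, ∑ e : Fin 5, C (H a c b d e) * X c * X d * X e := by
    rw [cubicSum_swap23 (fun c d e => H a e b c d), cubicSum_swap12 (fun c d e => H a d b c e)]
  have r3 : (∑ c : Fin 5, ∑ d : Fin 5, ∑ e : Fin 5, C (H b d a c e) * X c * X d * X e : MvPolynomial (Fin 5) ℂ)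
      = ∑ c : Fin 5, ∑ d : Fin 5, ∑ e : Fin 5, C (H b c a d e) * X c * X d * X e := by
    rw [cubicSum_swap12 (fun c d e => H b d a c e)]
  have r4 : (∑ c : Fin 5, ∑ d : Fin 5, ∑ e : Fin 5, C (H b e a c d) * X c * X d * X e : MvPolynomial (Fin 5) ℂ)
      = ∑ c : Fin 5, ∑ d : Fin 5, ∑ e : Fin 5, C (H b c a d e) * X c * X d * X e := by
    rw [cubicSum_swap23 (fun c d e => H b e a c d), cubicSum_swap12 (fun c d e => H b d a c e)]
  have r5 : (∑ c : Fin 5, ∑ d : Fin 5, ∑ e : Fin 5, C (H c e a b d) * X c * X d * X e : MvPolynomial (Fin 5) ℂ)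
      = ∑ c : Fin 5, ∑ d : Fin 5, ∑ e : Fin 5, C (H c d a b e) * X c * X d * X e := by
    rw [cubicSum_swap23 (fun c d e => H c e a b d)]
  have r6 : (∑ c : Fin 5, ∑ d : Fin 5, ∑ e : Fin 5, C (H d e a b c) * X c * X d * X e : MvPolynomial (Fin 5) ℂ)
      = ∑ c : Fin 5, ∑ d : Fin 5, ∑ e : Fin 5, C (H c d a b e) * X c * X d * X e := by
    rw [cubicSum_swap12 (fun c d e => H d e a b c), cubicSum_swap23 (fun c d e => H c e a b d)]
  -- split the ten-term sum
  have split : (∑ c : Fin 5, ∑ d : Fin 5, ∑ e : Fin 5,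
      C (H a b c d e + H a c b d e + H a d b c e + H a e b c d + H b c a d e + H b d a c e + H b e a c d
        + H c d a b e + H c e a b d + H d e a b c) * X c * X d * X e : MvPolynomial (Fin 5) ℂ)
      = (∑ c : Fin 5, ∑ d : Fin 5, ∑ e : Fin 5, C (H a b c d e) * X c * X d * X e)
        + (∑ c : Fin 5, ∑ d : Fin 5, ∑ e : Fin 5, C (H a c b d e) * X c * X d * X e)
        + (∑ c : Fin 5, ∑ d : Fin 5, ∑ e : Fin 5, C (H a d b c e) * X c * X d * X e)
        + (∑ c : Fin 5, ∑ d : Fin 5, ∑ e : Fin 5, C (H a e b c d) * X c * X d * X e)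
        + (∑ c : Fin 5, ∑ d : Fin 5, ∑ e : Fin 5, C (H b c a d e) * X c * X d * X e)
        + (∑ c : Fin 5, ∑ d : Fin 5, ∑ e : Fin 5, C (H b d a c e) * X c * X d * X e)
        + (∑ c : Fin 5, ∑ d : Fin 5, ∑ e : Fin 5, C (H b e a c d) * X c * X d * X e)
        + (∑ c : Fin 5, ∑ d : Fin 5, ∑ e : Fin 5, C (H c d a b e) * X c * X d * X e)
        + (∑ c : Fin 5, ∑ d : Fin 5, ∑ e : Fin 5, C (H c e a b d) * X c * X d * X e)
        + (∑ c : Fin 5, ∑ d : Fin 5, ∑ e : Fin 5, C (H d e a b c) * X c * X d * X e) := by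
    simp only [map_add, add_mul, Finset.sum_add_distrib]
  rw [split, r1, r2, r3, r4, r5, r6]
  -- and recombine
  symm
  rw [cubicSum_add _ (fun c d e => 2 * H a b c d e + 6 * H a c b d e + 6 * H b c a d e) (fun c d e => 6 * H c d a b e)
      (fun c d e => rfl),
    cubicSum_add _ (fun c d e => 2 * H a b c d e + 6 * H a c b d e) (fun c d e => 6 * H b c a d e) (fun c d e => rfl),
    cubicSum_add _ (fun c d e => 2 * H a b c d e) (fun c d e => 6 * H a c b d e) (fun c d e => rfl),
    cubicSum_smul, cubicSum_smul, cubicSum_smul, cubicSum_smul]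
  simp only [map_ofNat]
  ring
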